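/-
Copyright (c) 2026 the pub-hodgecm-mathlib formalisation cell (harness21).  Prover seat hodgecm-mathlib-F0P3a-p02 (g19): LH3 «Transf» road,
brick (GLUE-X-gen) (dealer LH3-plan (g2) ruling (6) 2026-09-02; split with F0P3a-p09 (g5) who cuts the chart dress (GLUE-X-dress)).
-/
import Mathlib.Analysis.Calculus.FDeriv.Extend
import Mathlib.Analysis.Calculus.ContDiff.Basic
import Mathlib.Analysis.Calculus.MeanValue
import Mathlib.Topology.ExtendFrom
import Mathlib.LinearAlgebra.Multilinear.Basis
import Literature.Analysis.Calculus.SmoothExtensionToClosure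
import HarnessLib

/-!
# Smooth gluing across a hyperplane from matching one-sided jets

Analysis/Calculus support file (everything PROVED; no definition, no named fact, no `sorry`).  The elementary lemma behind
«smooth up to the wall from both sides + no jump of any normal derivative ⇒ smooth across the wall» (used, e.g., in the
archimedean transfer of orbital integrals across a *compact* imaginary wall: D. Shelstad, *Characters and inner forms of a
quasi-split group over `ℝ`*, Compositio Math. 39 (1979), §4, proof of Thm. 4.7, case (IIIa) p. 31 — the `κ`-signed sum of the
two one-sided jumps vanishes, so the transferred function «extends to a `C^∞` function» across the wall; A. Bouaziz,
*Intégrales orbitales sur les groupes de Lie réductifs*, Ann. Sci. ÉNS 27 (1994), §3.2 p. 579: property (I₁) «sup_{K ∩ H_reg}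
|∂(u)ψ_H| < ∞ … Cette propriété et le lemme 1-3-21 de [V] impliquent que, si F est une composante connexe de H ∩ U_reg …, la
fonction ∂(u)ψ_H se prolonge par continuité à l'adhérence de F», and property (I₂) «ψ_H se prolonge en une fonction C^∞ sur
H_{in-reg} ∩ U» — this file is the formal content of that remark and of the (I₂)-gluing step, for ONE hyperplane wall).

Let `E` be a real normed space, `F` a complete real normed space, `ℓ : E →L[ℝ] ℝ` a continuous linear form, `a : ℝ`, and
`U ⊆ E` open; the WALL is `U ∩ {ℓ = a}` and `s := U ∩ {ℓ ≠ a}` is its open complement in `U`.  Let `f : E → F` be `C^∞` on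
`s`, and suppose that near every wall point every iterated derivative `Dⁿ f` is BOUNDED on `s` (Bouaziz (I₁) «ainsi que toutes
ses dérivées y sont bornées»).  Then (mean value inequality) every `Dⁿ f` is Lipschitz on each of the two convex open half-balls
at a wall point, hence has a limit at the wall from EACH side (`UniformContinuousOn.exists_tendsto_of_mem_closure`, ★
`SmoothExtensionToClosure`).  MAIN THEOREM (`contDiffOn_extendFrom_of_oneSidedLimits_eq`): if at every wall point and every
order the two one-sided limits of `Dⁿ f` AGREE, then the glue `extendFrom s f` (`= f` on `s`, `=` the common limit on the wall)
is `C^∞` on `U`.  Proof: the common limits form a continuous field `q n` on a ball; on each open half-ball Mathlib's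
one-derivative boundary lemma `hasFDerivWithinAt_closure_of_tendsto_fderiv` gives `HasFDerivWithinAt (q n) (q (n+1) x)` within
the CLOSED half-ball at a wall point `x`, and the union of the two closed half-balls is a neighbourhood of `x`
(`HasFDerivWithinAt.union`); so `q` is a Taylor series of the glue on the ball.

CONSUMER FORMS (the agreement read off ONE transversal ray `x + t • v`, tested on all words or on basis words — what
orbital-integral jump data deliver) are in the sequel file `SmoothGluingAcrossHyperplaneRay.lean`.  RIDERS here:
`extendFrom s f = f` on `s` and the iterated derivatives of the glue on `s` are those of `f`.

What is NOT here: no group, no orbital integral, no chart (the dress for the `κ`-signed transfer family `transfFam` is the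
separate file of F0P3a-p09); no extension theorem of Whitney∕Seeley type is used or proved (compare ★ `SeeleyExtension`,
★ `WhitneyConvexGluing`, which glue a WITHIN-jet on a closed half-space — here both sides are open and the wall values are
produced, not given).

## References
* A. Bouaziz, *Intégrales orbitales sur les groupes de Lie réductifs*, Ann. Sci. ÉNS (4) 27 (1994), §3.1–3.2 pp. 579–580.
* D. Shelstad, *Characters and inner forms of a quasi-split group over `ℝ`*, Compositio Math. 39 (1979), §4 pp. 22–31.
* J. Dieudonné, *Foundations of Modern Analysis* (1960), (8.6.3).
-/

noncomputable section

open Set Filter Metric Function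
open scoped Topology NNReal ContDiff

namespace Literature.Analysis.Calculus

variable {E : Type*} [NormedAddCommGroup E] [NormedSpace ℝ E]
  {F : Type*} [NormedAddCommGroup F] [NormedSpace ℝ F] [CompleteSpace F]

/-! ### §1 Elementary geometry of the two sides of the wall -/

section Sides

variable (ℓ : E →L[ℝ] ℝ) (a : ℝ)

/-- The open side `{a < ℓ}` is convex. [cite: Bouaziz1994IntegralesOrbitales, §3.2 (I₁)–(I₂) p. 579] -/
theorem convex_setOf_lt_apply : Convex ℝ {y : E | a < ℓ y} :=
  convex_halfSpace_gt ℓ.isLinear a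

/-- The open side `{ℓ < a}` is convex. [cite: Bouaziz1994IntegralesOrbitales, §3.2 (I₁)–(I₂) p. 579] -/
theorem convex_setOf_apply_lt : Convex ℝ {y : E | ℓ y < a} :=
  convex_halfSpace_lt ℓ.isLinear a

/-- The open side `{a < ℓ}` is open. [cite: Bouaziz1994IntegralesOrbitales, §3.2 (I₁)–(I₂) p. 579] -/
theorem isOpen_setOf_lt_apply : IsOpen {y : E | a < ℓ y} :=
  isOpen_lt continuous_const ℓ.continuous

/-- The open side `{ℓ < a}` is open. [cite: Bouaziz1994IntegralesOrbitales, §3.2 (I₁)–(I₂) p. 579] -/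
theorem isOpen_setOf_apply_lt : IsOpen {y : E | ℓ y < a} :=
  isOpen_lt ℓ.continuous continuous_const

/-- The complement of the wall `{ℓ ≠ a}` is open. [cite: Bouaziz1994IntegralesOrbitales, §3.2 (I₁)–(I₂) p. 579] -/
theorem isOpen_setOf_apply_ne : IsOpen {y : E | ℓ y ≠ a} :=
  isOpen_ne_fun ℓ.continuous continuous_const

variable {ℓ a}

/-- Along a transversal ray `x + t • v` with `0 < ℓ v` issued from a wall point, small positive times land in any
neighbourhood of `x` intersected with the side `{a < ℓ}`: the ray tends to `x` WITHIN that side. [cite: Bouaziz1994IntegralesOrbitales, §3.2 (I₁)–(I₂) p. 579] -/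
theorem tendsto_ray_nhdsWithin_lt_apply {x v : E} (hx : ℓ x = a) (hv : 0 < ℓ v) {t : Set E} (ht : t ∈ 𝓝 x) :
    Tendsto (fun r : ℝ => x + r • v) (𝓝[>] 0) (𝓝[t ∩ {y | a < ℓ y}] x) := by
  have h0 : Tendsto (fun r : ℝ => x + r • v) (𝓝 0) (𝓝 x) := by
    have : Continuous fun r : ℝ => x + r • v := by fun_prop
    simpa using this.tendsto 0
  refine tendsto_nhdsWithin_iff.2 ⟨h0.mono_left nhdsWithin_le_nhds, ?_⟩
  have h1 : ∀ᶠ r : ℝ in 𝓝[>] 0, x + r • v ∈ t :=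
    (h0.mono_left nhdsWithin_le_nhds).eventually (show ∀ᶠ y in 𝓝 x, y ∈ t from ht)
  have h2 : ∀ᶠ r : ℝ in 𝓝[>] 0, x + r • v ∈ {y : E | a < ℓ y} := by
    filter_upwards [self_mem_nhdsWithin] with r (hr : 0 < r)
    simp only [map_add, map_smul, smul_eq_mul, hx]
    nlinarith [mul_pos hr hv]
  exact h1.and h2

/-- Idem for negative times and the side `{ℓ < a}`. [cite: Bouaziz1994IntegralesOrbitales, §3.2 (I₁)–(I₂) p. 579] -/
theorem tendsto_ray_nhdsWithin_apply_lt {x v : E} (hx : ℓ x = a) (hv : 0 < ℓ v) {t : Set E} (ht : t ∈ 𝓝 x) :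
    Tendsto (fun r : ℝ => x + r • v) (𝓝[<] 0) (𝓝[t ∩ {y | ℓ y < a}] x) := by
  have h0 : Tendsto (fun r : ℝ => x + r • v) (𝓝 0) (𝓝 x) := by
    have : Continuous fun r : ℝ => x + r • v := by fun_prop
    simpa using this.tendsto 0
  refine tendsto_nhdsWithin_iff.2 ⟨h0.mono_left nhdsWithin_le_nhds, ?_⟩
  have h1 : ∀ᶠ r : ℝ in 𝓝[<] 0, x + r • v ∈ t :=
    (h0.mono_left nhdsWithin_le_nhds).eventually (show ∀ᶠ y in 𝓝 x, y ∈ t from ht)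
  have h2 : ∀ᶠ r : ℝ in 𝓝[<] 0, x + r • v ∈ {y : E | ℓ y < a} := by
    filter_upwards [self_mem_nhdsWithin] with r (hr : r < 0)
    simp only [map_add, map_smul, smul_eq_mul, hx]
    nlinarith [mul_neg_of_neg_of_pos hr hv]
  exact h1.and h2

/-- A wall point lies in the closure of (any neighbourhood intersected with) the side `{a < ℓ}`, provided `ℓ ≠ 0`
(witnessed by `0 < ℓ v`). [cite: Bouaziz1994IntegralesOrbitales, §3.2 (I₁)–(I₂) p. 579] -/
theorem mem_closure_inter_lt_apply {x v : E} (hx : ℓ x = a) (hv : 0 < ℓ v) {t : Set E} (ht : t ∈ 𝓝 x) :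
    x ∈ closure (t ∩ {y | a < ℓ y}) := by
  rw [mem_closure_iff_nhdsWithin_neBot]
  exact (tendsto_ray_nhdsWithin_lt_apply hx hv ht).neBot

/-- Idem for the side `{ℓ < a}`. [cite: Bouaziz1994IntegralesOrbitales, §3.2 (I₁)–(I₂) p. 579] -/
theorem mem_closure_inter_apply_lt {x v : E} (hx : ℓ x = a) (hv : 0 < ℓ v) {t : Set E} (ht : t ∈ 𝓝 x) :
    x ∈ closure (t ∩ {y | ℓ y < a}) := by
  rw [mem_closure_iff_nhdsWithin_neBot]
  exact (tendsto_ray_nhdsWithin_apply_lt hx hv ht).neBot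

/-- An open set `t` is covered by the closures of its two open sides together (the wall points of `t` are limits from
the side `{a < ℓ}`), provided `ℓ ≠ 0`. [cite: Bouaziz1994IntegralesOrbitales, §3.2 (I₁)–(I₂) p. 579] -/
theorem subset_closure_union_closure {v : E} (hv : 0 < ℓ v) {t : Set E} (ht : IsOpen t) :
    t ⊆ closure (t ∩ {y | a < ℓ y}) ∪ closure (t ∩ {y | ℓ y < a}) := by
  intro z hz
  rcases lt_trichotomy a (ℓ z) with h | h | h
  · exact Or.inl (subset_closure ⟨hz, h⟩)
  · exact Or.inl (mem_closure_inter_lt_apply h.symm hv (ht.mem_nhds hz))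
  · exact Or.inr (subset_closure ⟨hz, h⟩)

omit [NormedSpace ℝ E] in
/-- At a point of an open set `t`, the filter within `t ∩ A` is the filter within `A`. [cite: Bouaziz1994IntegralesOrbitales, §3.2 (I₁)–(I₂) p. 579] -/
theorem nhdsWithin_inter_eq_of_isOpen {t A : Set E} (ht : IsOpen t) {x : E} (hx : x ∈ t) :
    𝓝[t ∩ A] x = 𝓝[A] x :=
  nhdsWithin_inter_of_mem (mem_nhdsWithin_of_mem_nhds (ht.mem_nhds hx))

end Sides

/-! ### §2 One-sided limits of the jets from bounded higher jets (one convex open piece) -/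

section OneSide

omit [CompleteSpace F] in
/-- **Bounded `(m+1)`-st derivative on a convex open piece `A` of the open set `s` where `f` is smooth ⇒ the `m`-th
derivative is Lipschitz on `A`** (mean value inequality; the derivative of `x ↦ Dᵐf(x)` is the left-curried `Dᵐ⁺¹f(x)`,
of the same norm). [cite: Bouaziz1994IntegralesOrbitales, §3.2 (I₁)–(I₂) p. 579] -/
theorem lipschitzOnWith_iteratedFDeriv_of_bound {s A : Set E} (hs : IsOpen s) (hA : Convex ℝ A) (hAs : A ⊆ s)
    {f : E → F} (hf : ContDiffOn ℝ ∞ f s) {m : ℕ} {C : ℝ≥0}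
    (hC : ∀ y ∈ A, ‖iteratedFDeriv ℝ (m + 1) f y‖ ≤ C) :
    LipschitzOnWith C (iteratedFDeriv ℝ m f) A := by
  have hp : HasFTaylorSeriesUpToOn ∞ f (ftaylorSeriesWithin ℝ f s) s := hf.ftaylorSeriesWithin hs.uniqueDiffOn
  have hder : ∀ y ∈ A, HasFDerivWithinAt (iteratedFDeriv ℝ m f)
      (iteratedFDeriv ℝ (m + 1) f y).curryLeft A y := by
    intro y hy
    have h1 := hp.fderivWithin m (by exact_mod_cast ENat.coe_lt_top m) y (hAs hy)
    -- rewrite the within-series on the open set `s` as plain iterated derivatives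
    have h2 : HasFDerivWithinAt (iteratedFDerivWithin ℝ m f s) (iteratedFDerivWithin ℝ (m + 1) f s y).curryLeft s y := h1
    have h3 : HasFDerivWithinAt (iteratedFDeriv ℝ m f) (iteratedFDerivWithin ℝ (m + 1) f s y).curryLeft s y :=
      h2.congr (fun z hz => (iteratedFDerivWithin_of_isOpen m hs hz).symm) (iteratedFDerivWithin_of_isOpen m hs (hAs hy)).symm
    rw [iteratedFDerivWithin_of_isOpen (m + 1) hs (hAs hy)] at h3
    exact h3.mono hAs
  refine hA.lipschitzOnWith_of_nnnorm_hasFDerivWithin_le hder fun y hy => ?_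
  have h1 : ‖(iteratedFDeriv ℝ (m + 1) f y).curryLeft‖ ≤ C := by
    rw [ContinuousMultilinearMap.curryLeft_norm]; exact hC y hy
  exact_mod_cast h1

/-- **One-sided limits of the jets.** On a convex open piece `A ⊆ s` where `Dᵐ⁺¹f` is bounded, `Dᵐf` has a limit within `A`
at every point of `closure A`. [cite: Bouaziz1994IntegralesOrbitales, §3.2 (I₁)–(I₂) p. 579] -/
theorem exists_tendsto_iteratedFDeriv_of_bound {s A : Set E} (hs : IsOpen s) (hA : Convex ℝ A) (hAs : A ⊆ s)
    {f : E → F} (hf : ContDiffOn ℝ ∞ f s) {m : ℕ} {C : ℝ}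
    (hC : ∀ y ∈ A, ‖iteratedFDeriv ℝ (m + 1) f y‖ ≤ C) {x : E} (hx : x ∈ closure A) :
    ∃ l : E [×m]→L[ℝ] F, Tendsto (iteratedFDeriv ℝ m f) (𝓝[A] x) (𝓝 l) := by
  have hC' : ∀ y ∈ A, ‖iteratedFDeriv ℝ (m + 1) f y‖ ≤ (⟨max C 0, le_max_right _ _⟩ : ℝ≥0) :=
    fun y hy => (hC y hy).trans (le_max_left _ _)
  exact (lipschitzOnWith_iteratedFDeriv_of_bound hs hA hAs hf hC').uniformContinuousOn.exists_tendsto_of_mem_closure hx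

end OneSide

/-! ### §3 The main theorem: agreement of the one-sided limits ⇒ the glue is `C^∞` -/

section Main

variable (ℓ : E →L[ℝ] ℝ) (a : ℝ)

/-- **SMOOTH GLUING ACROSS A HYPERPLANE (limit form).**  `U` open, `s := U ∩ {ℓ ≠ a}`, `f` `C^∞` on `s`, every `Dⁿf` bounded
on `s` near each wall point of `U`, and at every wall point and every order the one-sided limits of `Dⁿf` (within `{a < ℓ}`
and within `{ℓ < a}`) AGREE whenever both exist.  Then `extendFrom s f` is `C^∞` on `U`.  (`ℓ v ≠ 0` only records `ℓ ≠ 0`.)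
[cite: Bouaziz1994IntegralesOrbitales, §3.2 (I₁)–(I₂) p. 579] -/
theorem contDiffOn_extendFrom_of_oneSidedLimits_eq {v : E} (hv : ℓ v ≠ 0) {U : Set E} (hU : IsOpen U) {f : E → F}
    (hf : ContDiffOn ℝ ∞ f (U ∩ {y | ℓ y ≠ a}))
    (hb : ∀ x ∈ U, ℓ x = a → ∀ n : ℕ, ∃ C : ℝ, ∀ᶠ y in 𝓝 x, ℓ y ≠ a → ‖iteratedFDeriv ℝ n f y‖ ≤ C)
    (hagree : ∀ x ∈ U, ℓ x = a → ∀ (n : ℕ) (l₁ l₂ : E [×n]→L[ℝ] F),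
      Tendsto (iteratedFDeriv ℝ n f) (𝓝[{y | a < ℓ y}] x) (𝓝 l₁) →
      Tendsto (iteratedFDeriv ℝ n f) (𝓝[{y | ℓ y < a}] x) (𝓝 l₂) → l₁ = l₂) :
    ContDiffOn ℝ ∞ (extendFrom (U ∩ {y | ℓ y ≠ a}) f) U := by
  -- WLOG the transversal direction points to the side `{a < ℓ}`
  obtain ⟨v, hv⟩ : ∃ v' : E, 0 < ℓ v' := by
    rcases lt_or_gt_of_ne hv with h | h
    · exact ⟨-v, by simpa using h⟩
    · exact ⟨v, h⟩
  set s : Set E := U ∩ {y | ℓ y ≠ a} with hsdef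
  have hs : IsOpen s := hU.inter (isOpen_setOf_apply_ne ℓ a)
  -- the glue agrees with `f` on `s`
  have hgs : EqOn (extendFrom s f) f s := fun y hy => extendFrom_extends hf.continuousOn y hy
  -- plain iterated derivatives of `f` are continuous on the open set `s` and differentiate each other
  have hcontf : ∀ m : ℕ, ContinuousOn (iteratedFDeriv ℝ m f) s := fun m =>
    (hf.continuousOn_iteratedFDerivWithin (m := m) (by exact_mod_cast le_top) hs.uniqueDiffOn).congr
      fun z hz => (iteratedFDerivWithin_of_isOpen m hs hz).symm
  have hp : HasFTaylorSeriesUpToOn ∞ f (ftaylorSeriesWithin ℝ f s) s := hf.ftaylorSeriesWithin hs.uniqueDiffOn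
  have hderf : ∀ (m : ℕ), ∀ y ∈ s, HasFDerivAt (iteratedFDeriv ℝ m f) (iteratedFDeriv ℝ (m + 1) f y).curryLeft y := by
    intro m y hy
    have h1 := hp.fderivWithin m (by exact_mod_cast ENat.coe_lt_top m) y hy
    have h2 : HasFDerivWithinAt (iteratedFDeriv ℝ m f) (iteratedFDerivWithin ℝ (m + 1) f s y).curryLeft s y :=
      h1.congr (fun z hz => (iteratedFDerivWithin_of_isOpen m hs hz).symm) (iteratedFDerivWithin_of_isOpen m hs hy).symm
    rw [iteratedFDerivWithin_of_isOpen (m + 1) hs hy] at h2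
    exact h2.hasFDerivAt (hs.mem_nhds hy)
  -- it is `C^N` near every point, for every finite `N`
  rw [contDiffOn_infty]
  intro N
  refine contDiffOn_of_locally_contDiffOn fun x hxU => ?_
  by_cases hxa : ℓ x ≠ a
  · -- off the wall: the glue is `f` on the open set `s`
    refine ⟨s, hs, ⟨hxU, hxa⟩, ?_⟩
    exact ((hf.of_le (by exact_mod_cast le_top)).congr hgs).mono inter_subset_right
  push Not at hxa
  -- at a wall point: a ball `B ⊆ U` on which the jets of orders `≤ N+1` are bounded off the wall
  obtain ⟨C, hC⟩ : ∃ C : Fin (N + 2) → ℝ, ∀ i : Fin (N + 2), ∀ᶠ y in 𝓝 x, ℓ y ≠ a → ‖iteratedFDeriv ℝ i f y‖ ≤ C i := by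
    choose C hC using fun i : Fin (N + 2) => hb x hxU hxa i
    exact ⟨C, hC⟩
  have hev : ∀ᶠ y in 𝓝 x, y ∈ U ∧ ∀ i : Fin (N + 2), ℓ y ≠ a → ‖iteratedFDeriv ℝ i f y‖ ≤ C i :=
    (hU.eventually_mem hxU).and (eventually_all.2 hC)
  obtain ⟨r, hr, hB⟩ := Metric.eventually_nhds_iff_ball.1 hev
  set B : Set E := ball x r with hBdef
  have hBU : B ⊆ U := fun y hy => (hB y hy).1
  have hBo : IsOpen B := isOpen_ball
  have hxB : x ∈ B := mem_ball_self hr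
  have hbound : ∀ (m : ℕ) (hm : m ≤ N + 1), ∀ y ∈ B, ℓ y ≠ a → ‖iteratedFDeriv ℝ m f y‖ ≤ C ⟨m, by omega⟩ :=
    fun m hm y hy hya => (hB y hy).2 ⟨m, by omega⟩ hya
  -- the two open half-balls
  set Ap : Set E := B ∩ {y | a < ℓ y} with hApdef
  set Am : Set E := B ∩ {y | ℓ y < a} with hAmdef
  have hAps : Ap ⊆ s := fun y hy => ⟨hBU hy.1, ne_of_gt hy.2⟩
  have hAms : Am ⊆ s := fun y hy => ⟨hBU hy.1, ne_of_lt hy.2⟩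
  have hApc : Convex ℝ Ap := (convex_ball x r).inter (convex_setOf_lt_apply ℓ a)
  have hAmc : Convex ℝ Am := (convex_ball x r).inter (convex_setOf_apply_lt ℓ a)
  have hBs : B ∩ s = Ap ∪ Am := by
    ext y; constructor
    · rintro ⟨hyB, -, hya⟩
      rcases lt_or_gt_of_ne hya with h | h
      · exact Or.inr ⟨hyB, h⟩
      · exact Or.inl ⟨hyB, h⟩
    · rintro (⟨hyB, h⟩ | ⟨hyB, h⟩)
      · exact ⟨hyB, hBU hyB, ne_of_gt h⟩
      · exact ⟨hyB, hBU hyB, ne_of_lt h⟩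
  -- one-sided limits of the jets of orders `≤ N` exist at the points of the closures of the half-balls
  have hlimp : ∀ m : ℕ, m ≤ N → ∀ y ∈ closure Ap, ∃ l, Tendsto (iteratedFDeriv ℝ m f) (𝓝[Ap] y) (𝓝 l) :=
    fun m hm y hy => exists_tendsto_iteratedFDeriv_of_bound hs hApc hAps hf
      (fun z hz => hbound (m + 1) (by omega) z hz.1 (ne_of_gt hz.2)) hy
  have hlimm : ∀ m : ℕ, m ≤ N → ∀ y ∈ closure Am, ∃ l, Tendsto (iteratedFDeriv ℝ m f) (𝓝[Am] y) (𝓝 l) :=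
    fun m hm y hy => exists_tendsto_iteratedFDeriv_of_bound hs hAmc hAms hf
      (fun z hz => hbound (m + 1) (by omega) z hz.1 (ne_of_lt hz.2)) hy
  -- hence limits WITHIN `s` at every point of `B` (at the wall points the two one-sided limits agree)
  have hlim : ∀ m : ℕ, m ≤ N → ∀ y ∈ B, ∃ l, Tendsto (iteratedFDeriv ℝ m f) (𝓝[s] y) (𝓝 l) := by
    intro m hm y hyB
    by_cases hya : ℓ y ≠ a
    · exact ⟨_, hcontf m y ⟨hBU hyB, hya⟩⟩
    push Not at hya
    obtain ⟨l₁, hl₁⟩ := hlimp m hm y (mem_closure_inter_lt_apply hya hv (hBo.mem_nhds hyB))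
    obtain ⟨l₂, hl₂⟩ := hlimm m hm y (mem_closure_inter_apply_lt hya hv (hBo.mem_nhds hyB))
    have e₁ : 𝓝[Ap] y = 𝓝[{y | a < ℓ y}] y := nhdsWithin_inter_eq_of_isOpen hBo hyB
    have e₂ : 𝓝[Am] y = 𝓝[{y | ℓ y < a}] y := nhdsWithin_inter_eq_of_isOpen hBo hyB
    have h12 : l₁ = l₂ := hagree y (hBU hyB) hya m l₁ l₂ (e₁ ▸ hl₁) (e₂ ▸ hl₂)
    subst h12
    refine ⟨l₁, ?_⟩
    rw [← nhdsWithin_inter_eq_of_isOpen hBo hyB (A := s), hBs, nhdsWithin_union]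
    exact tendsto_sup.2 ⟨hl₁, hl₂⟩
  -- the glued jets `q`
  set q : E → FormalMultilinearSeries ℝ E F := fun y m => extendFrom s (iteratedFDeriv ℝ m f) y with hqdef
  have hq_tend : ∀ m : ℕ, m ≤ N → ∀ y ∈ B, Tendsto (iteratedFDeriv ℝ m f) (𝓝[s] y) (𝓝 (q y m)) :=
    fun m hm y hy => tendsto_extendFrom (hlim m hm y hy)
  have hBcl : B ⊆ closure s := by
    intro y hy
    have h1 := subset_closure_union_closure (a := a) hv hBo hy
    rcases h1 with h | h
    · exact closure_mono hAps h
    · exact closure_mono hAms h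
  have hq_eq : ∀ m : ℕ, ∀ y ∈ s, q y m = iteratedFDeriv ℝ m f y :=
    fun m y hy => extendFrom_eq (subset_closure hy) (hcontf m y hy)
  have hq_cont : ∀ m : ℕ, m ≤ N → ContinuousOn (q · m) B :=
    fun m hm => continuousOn_extendFrom hBcl (hlim m hm)
  have hq_ev : ∀ m : ℕ, ∀ y ∈ s, (fun z => q z m) =ᶠ[𝓝 y] iteratedFDeriv ℝ m f :=
    fun m y hy => Filter.eventually_of_mem (hs.mem_nhds hy) fun z hz => hq_eq m z hz
  have hderq_s : ∀ m : ℕ, ∀ y ∈ s, HasFDerivAt (q · m) (iteratedFDeriv ℝ (m + 1) f y).curryLeft y :=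
    fun m y hys => (hderf m y hys).congr_of_eventuallyEq (hq_ev m y hys)
  -- the glued jets differentiate each other on `B` (orders `< N`)
  have hderq : ∀ m : ℕ, m < N → ∀ y ∈ B, HasFDerivWithinAt (q · m) (q y (m + 1)).curryLeft B y := by
    intro m hm y hyB
    by_cases hya : ℓ y ≠ a
    · have hys : y ∈ s := ⟨hBU hyB, hya⟩
      have h1 := hderq_s m y hys
      rw [← hq_eq (m + 1) y hys] at h1
      exact h1.hasFDerivWithinAt
    push Not at hya
    -- a smaller ball whose closure stays in `B`
    obtain ⟨δ, hδ, hδB⟩ : ∃ δ > 0, closedBall y δ ⊆ B := by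
      obtain ⟨δ, hδ, h⟩ := Metric.mem_nhds_iff.1 (hBo.mem_nhds hyB)
      exact ⟨δ / 2, half_pos hδ, (closedBall_subset_ball (half_lt_self hδ)).trans h⟩
    -- the one-derivative boundary lemma on each open half of the small ball
    have hstep : ∀ (A : Set E), Convex ℝ A → IsOpen A → A ⊆ s → closure A ⊆ B →
        HasFDerivWithinAt (q · m) (q y (m + 1)).curryLeft (closure A) y := by
      intro A hAc hAo hAs' hAB
      refine hasFDerivWithinAt_closure_of_tendsto_fderiv ?_ hAc hAo ?_ ?_
      · exact fun z hz => (hderq_s m z (hAs' hz)).differentiableAt.differentiableWithinAt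
      · exact fun z hz => ((hq_cont m hm.le) z (hAB hz)).mono (subset_closure.trans hAB)
      · have h1 : ∀ z ∈ A, fderiv ℝ (fun w => q w m) z = (iteratedFDeriv ℝ (m + 1) f z).curryLeft :=
          fun z hz => (hderq_s m z (hAs' hz)).fderiv
        have h2 : Tendsto (fun z => (iteratedFDeriv ℝ (m + 1) f z).curryLeft) (𝓝[A] y)
            (𝓝 (q y (m + 1)).curryLeft) :=
          ((continuousMultilinearCurryLeftEquiv ℝ (fun _ : Fin (m + 1) => E) F).continuous.tendsto _).comp
            ((hq_tend (m + 1) (by omega) y hyB).mono_left (nhdsWithin_mono _ hAs'))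
        exact h2.congr' (eventually_of_mem self_mem_nhdsWithin fun z hz => (h1 z hz).symm)
    have hb' : ball y δ ⊆ B := ball_subset_closedBall.trans hδB
    have hcl : ∀ A' : Set E, closure (ball y δ ∩ A') ⊆ B := fun A' =>
      ((closure_mono inter_subset_left).trans closure_ball_subset_closedBall).trans hδB
    have h₁ := hstep (ball y δ ∩ {z | a < ℓ z}) ((convex_ball y δ).inter (convex_setOf_lt_apply ℓ a))
      (isOpen_ball.inter (isOpen_setOf_lt_apply ℓ a)) (fun z hz => ⟨hBU (hb' hz.1), ne_of_gt hz.2⟩) (hcl _)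
    have h₂ := hstep (ball y δ ∩ {z | ℓ z < a}) ((convex_ball y δ).inter (convex_setOf_apply_lt ℓ a))
      (isOpen_ball.inter (isOpen_setOf_apply_lt ℓ a)) (fun z hz => ⟨hBU (hb' hz.1), ne_of_lt hz.2⟩) (hcl _)
    have h₃ : HasFDerivWithinAt (q · m) (q y (m + 1)).curryLeft (ball y δ) y :=
      (h₁.union h₂).mono (subset_closure_union_closure (a := a) hv isOpen_ball)
    exact (h₃.hasFDerivAt (ball_mem_nhds y hδ)).hasFDerivWithinAt
  -- so `q` is a Taylor series, up to order `N`, of `y ↦ (q y 0).curry0` on `B`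
  have hQ : HasFTaylorSeriesUpToOn N (fun y => (q y 0).curry0) q B := by
    refine ⟨fun y _ => rfl, fun m hm y hy => hderq m (by exact_mod_cast hm) y hy, fun m hm => hq_cont m (by exact_mod_cast hm)⟩
  -- and that function is the glue on `B`
  have hgB : EqOn (extendFrom s f) (fun y => (q y 0).curry0) B := by
    intro y hyB
    refine extendFrom_eq (hBcl hyB) ?_
    have h1 : Tendsto (fun z => (iteratedFDeriv ℝ 0 f z).curry0) (𝓝[s] y) (𝓝 (q y 0).curry0) :=
      ((continuousMultilinearCurryFin0 ℝ E F).continuous.tendsto _).comp (hq_tend 0 (Nat.zero_le _) y hyB)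
    exact h1.congr' (eventually_of_mem self_mem_nhdsWithin fun z _ => iteratedFDeriv_zero_apply (𝕜 := ℝ) _)
  refine ⟨B, hBo, hxB, ?_⟩
  exact (hQ.contDiffOn.congr hgB).mono inter_subset_right

variable {ℓ a}

omit [CompleteSpace F] in
/-- **RIDER: the glue is `f` off the wall.** [cite: Bouaziz1994IntegralesOrbitales, §3.2 (I₁)–(I₂) p. 579] -/
theorem extendFrom_eq_self_of_contDiffOn {U : Set E} {f : E → F}
    (hf : ContDiffOn ℝ ∞ f (U ∩ {y | ℓ y ≠ a})) :
    EqOn (extendFrom (U ∩ {y | ℓ y ≠ a}) f) f (U ∩ {y | ℓ y ≠ a}) :=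
  fun y hy => extendFrom_extends hf.continuousOn y hy

omit [CompleteSpace F] in
/-- **RIDER: off the wall the glue and `f` agree near every point, so all their iterated derivatives agree there.**
[cite: Bouaziz1994IntegralesOrbitales, §3.2 (I₁)–(I₂) p. 579] -/
theorem iteratedFDeriv_extendFrom_eq_of_mem {U : Set E} (hU : IsOpen U) {f : E → F}
    (hf : ContDiffOn ℝ ∞ f (U ∩ {y | ℓ y ≠ a})) {y : E} (hy : y ∈ U ∩ {y | ℓ y ≠ a}) (n : ℕ) :
    iteratedFDeriv ℝ n (extendFrom (U ∩ {y | ℓ y ≠ a}) f) y = iteratedFDeriv ℝ n f y := by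
  have hs : IsOpen (U ∩ {y | ℓ y ≠ a}) := hU.inter (isOpen_setOf_apply_ne ℓ a)
  have hev : extendFrom (U ∩ {y | ℓ y ≠ a}) f =ᶠ[𝓝 y] f :=
    Filter.eventually_of_mem (hs.mem_nhds hy) (extendFrom_eq_self_of_contDiffOn hf)
  exact hev.iteratedFDeriv ℝ n |>.self_of_nhds

end Main

end Literature.Analysis.Calculus
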